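import Summits.Ventures.PercRepro2.CaseOneGadgetUWA1BMainII
import Summits.Ventures.PercRepro2.CaseOneGadgetUWA1BMainIIQ
import Summits.Ventures.PercRepro2.CaseOneGadgetUWA1BMainI
import Summits.Ventures.PercRepro2.CaseOneGadgetUWA1BMainIQ
import Summits.Ventures.PercRepro2.CaseOnePendantTreeMarks
import Summits.Ventures.PercRepro2.CaseOneClosedAtIff

/-!
# The gadget `u ~ {w, a₁, b}`, `w ~ {u, a₂, o}` (uwa1b): the closed anchor — all four forms, `(J1₁)`, pendant trees
(blind cell PercRepro2, p1 g37; S5: the fifth gadget anchor of the four-form calculus — the uwa1b row closed on all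
four cells: the Q-forms by PLAIN SFacts-cone chains (kits j318477 / j319447), the (ii) / (i) forms by chains over
`SFactsB` = SFacts + the two-mark avoidance inequality hB1 (`CaseOne.HB1_holds`, CaseOneHB1Avoid), discharged by
`sFactsB` at every product law (P1-HB1 §6); own code, on the pattern of CaseOneGadgetUWA1OAnchor)

With the four chain heads `zSplitII_of_gadgetUWA1B` / `zSplitIIQ_of_gadgetUWA1B` / `zSplitI_of_gadgetUWA1B` /
`zSplitIQ_of_gadgetUWA1B` (CaseOneGadgetUWA1BMain*), a uwa1b-gadget vertex has **all four forms for every finite graph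
and every weight vector** (`fourForms_of_gadgetUWA1B`), hence `(J1₁)` there (`jOneOne_of_gadgetUWA1B`, K1); it is a
closed anchor in the sense of the pendant-tree closure (`GadgetUWA1BAnchor`, `fourFormsAll_of_gadgetUWA1BAnchor`): every
vertex of every pendant tree hanging at a uwa1b-gadget vertex has the four forms, `(J1₁)` and — where `P(T′) > 0` —
`(RV)` (`fourForms_of_pendantTree_gadgetUWA1B`, `jOneOne_of_pendantTree_gadgetUWA1B`, `rv_of_pendantTree_gadgetUWA1B`),
and every instance reachable from a uwa1b-gadget vertex by the moves of CaseOneMoves is closed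
(`closedAt_of_gadgetUWA1BAnchor`, `closedAt_of_moves_gadgetUWA1B`, `fourForms_of_moves_gadgetUWA1B`). The uwa1b shape
is not symmetric in the roots (`u ~ a₁`, `w ~ a₂`), so no `(J1)` (which needs the mirror shape) is claimed.
Standard axioms. -/

namespace Summit.Ventures.PercRepro2

namespace CaseOne

universe u

section Vertex
variable {V : Type*} {E : Type*} [Fintype E] [DecidableEq E] [Fintype V] [DecidableEq V]
  {R : Type*} [Field R] [LinearOrder R] [IsStrictOrderedRing R]
variable {ends : E → Sym2 V} {o a₁ a₂ b u w : V} {euw eua1 eub ewa2 ewo : E}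

/-- **All four forms at a uwa1b-gadget vertex**, every finite graph, every weight vector. -/
theorem fourForms_of_gadgetUWA1B (p : E → R) (hp : IsProbVec p)
    (h : IsGadgetUWA1B ends o a₁ a₂ b u w euw eua1 eub ewa2 ewo) : FourForms p ends o a₁ a₂ u b :=
  ⟨zSplitII_of_gadgetUWA1B p hp h, zSplitIIQ_of_gadgetUWA1B p hp h, zSplitI_of_gadgetUWA1B p hp h,
    zSplitIQ_of_gadgetUWA1B p hp h⟩

/-- **`(J1₁)` at a uwa1b-gadget vertex** (K1: `(i)` and `(ii)` give `(J1₁)`). -/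
theorem jOneOne_of_gadgetUWA1B (p : E → R) (hp : IsProbVec p)
    (h : IsGadgetUWA1B ends o a₁ a₂ b u w euw eua1 eub ewa2 ewo) : JOneOne p ends o a₁ a₂ u b :=
  jOneOne_of_i_of_ii p ends o a₁ a₂ u b (zSplitI_of_gadgetUWA1B p hp h) (zSplitII_of_gadgetUWA1B p hp h)

end Vertex

section AnchorDef
variable {V : Type*}

/-- The uwa1b-gadget anchor: `v ~ {w, a₁, b}` with `w ~ {v, a₂, o}` for some unmarked `w`. -/
def GadgetUWA1BAnchor (o a₁ a₂ b : V) (E : Type u) (ends : E → Sym2 V) (v : V) : Prop :=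
  ∃ (w : V) (euw eua1 eub ewa2 ewo : E), IsGadgetUWA1B ends o a₁ a₂ b v w euw eua1 eub ewa2 ewo

end AnchorDef

section Anchor
variable {V : Type*} [Fintype V] [DecidableEq V] {R : Type*} [Field R] [LinearOrder R]
  [IsStrictOrderedRing R]

variable (o a₁ a₂ b : V)

/-- A uwa1b-gadget anchor has the four forms. -/
theorem fourForms_of_gadgetUWA1BAnchor (E : Type u) [Fintype E] [DecidableEq E] (ends : E → Sym2 V)
    (p : E → R) (hp : IsProbVec p) (v : V) (h : GadgetUWA1BAnchor o a₁ a₂ b E ends v) :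
    FourForms p ends o a₁ a₂ v b := by
  obtain ⟨w, euw, eua1, eub, ewa2, ewo, h⟩ := h
  exact fourForms_of_gadgetUWA1B p hp h

/-- A uwa1b-gadget anchor is closed for every weight vector: `FourFormsAll`. -/
theorem fourFormsAll_of_gadgetUWA1BAnchor (E : Type u) [Fintype E] [DecidableEq E] (ends : E → Sym2 V)
    (v : V) (h : GadgetUWA1BAnchor o a₁ a₂ b E ends v) : FourFormsAll R o a₁ a₂ b E ends v := by
  intro _ _ p hp
  exact fourForms_of_gadgetUWA1BAnchor o a₁ a₂ b E ends p hp v h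

/-- A uwa1b-gadget anchor is closed: `ClosedAt`. -/
theorem closedAt_of_gadgetUWA1BAnchor (E : Type u) [Fintype E] [DecidableEq E] (ends : E → Sym2 V)
    (v : V) (h : GadgetUWA1BAnchor o a₁ a₂ b E ends v) : ClosedAt R o a₁ a₂ b E ends v :=
  fun p hp => fourForms_of_gadgetUWA1BAnchor o a₁ a₂ b E ends p hp v h

/-- **Every instance reachable by moves from a uwa1b-gadget vertex is closed.** -/
theorem closedAt_of_moves_gadgetUWA1B {E' : Type u} [Fintype E'] [DecidableEq E'] {ends' : E' → Sym2 V}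
    {v' : V} (h' : GadgetUWA1BAnchor o a₁ a₂ b E' ends' v') {E : Type u} [Fintype E] [DecidableEq E]
    {ends : E → Sym2 V} {v : V} (h : Moves o a₁ a₂ b E' ends' v' E ends v) :
    ClosedAt R o a₁ a₂ b E ends v :=
  closedAt_of_moves h (closedAt_of_gadgetUWA1BAnchor o a₁ a₂ b E' ends' v' h')

/-- The four forms for one weight vector on every instance reachable by moves from a uwa1b-gadget vertex. -/
theorem fourForms_of_moves_gadgetUWA1B {E' : Type u} [Fintype E'] [DecidableEq E'] {ends' : E' → Sym2 V}
    {v' : V} (h' : GadgetUWA1BAnchor o a₁ a₂ b E' ends' v') {E : Type u} [Fintype E] [DecidableEq E]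
    {ends : E → Sym2 V} {v : V} (h : Moves o a₁ a₂ b E' ends' v' E ends v) (p : E → R)
    (hp : IsProbVec p) : FourForms p ends o a₁ a₂ v b :=
  closedAt_of_moves_gadgetUWA1B o a₁ a₂ b h' h p hp

variable {E : Type u} [Fintype E] [DecidableEq E] {ends : E → Sym2 V} {v a₃ y : V} {S : Set V} {n : ℕ}

/-- **The four forms at the end of a pendant path of any length at a uwa1b-gadget vertex**, every finite
graph, every weight vector. -/
theorem fourForms_of_pendantPath_gadgetUWA1B (p : E → R) (hp : IsProbVec p)
    (h : IsPendantPathAt (GadgetUWA1BAnchor o a₁ a₂ b) o a₁ a₂ b n E ends v a₃) :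
    FourForms p ends o a₁ a₂ a₃ b :=
  fourForms_of_pendantPath (GadgetUWA1BAnchor o a₁ a₂ b) o a₁ a₂ b
    (fourForms_of_gadgetUWA1BAnchor o a₁ a₂ b) n E ends p hp v a₃ h

/-- **`(RV)` at the end of a pendant path of any length at a uwa1b-gadget vertex** (where `P(T′) > 0`). -/
theorem rv_of_pendantPath_gadgetUWA1B (p : E → R) (hp : IsProbVec p)
    (h : IsPendantPathAt (GadgetUWA1BAnchor o a₁ a₂ b) o a₁ a₂ b n E ends v a₃)
    (hT : 0 < prob p (Tp ends a₁ a₂ a₃)) : RV p ends o a₁ a₂ a₃ b :=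
  rv_of_pendantPath (GadgetUWA1BAnchor o a₁ a₂ b) (fourForms_of_gadgetUWA1BAnchor o a₁ a₂ b) p hp h hT

/-- **The four forms at every vertex of every pendant tree hanging at a uwa1b-gadget vertex**, every finite
graph, every weight vector. -/
theorem fourForms_of_pendantTree_gadgetUWA1B (p : E → R) (hp : IsProbVec p)
    (h : IsPendantTreeAt (GadgetUWA1BAnchor o a₁ a₂ b) o a₁ a₂ b n E ends v S) (hy : y ∈ S) :
    FourForms p ends o a₁ a₂ y b :=
  fourForms_of_pendantTree (GadgetUWA1BAnchor o a₁ a₂ b) o a₁ a₂ b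
    (fourForms_of_gadgetUWA1BAnchor o a₁ a₂ b) n E ends p hp v S h y hy

/-- **`(J1₁)` at every vertex of every pendant tree hanging at a uwa1b-gadget vertex.** -/
theorem jOneOne_of_pendantTree_gadgetUWA1B (p : E → R) (hp : IsProbVec p)
    (h : IsPendantTreeAt (GadgetUWA1BAnchor o a₁ a₂ b) o a₁ a₂ b n E ends v S) (hy : y ∈ S) :
    JOneOne p ends o a₁ a₂ y b :=
  jOneOne_of_i_of_ii p ends o a₁ a₂ y b (fourForms_of_pendantTree_gadgetUWA1B o a₁ a₂ b p hp h hy).2.2.1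
    (fourForms_of_pendantTree_gadgetUWA1B o a₁ a₂ b p hp h hy).1

/-- **`(RV)` at every vertex of every pendant tree hanging at a uwa1b-gadget vertex** (where `P(T′) > 0`). -/
theorem rv_of_pendantTree_gadgetUWA1B (p : E → R) (hp : IsProbVec p)
    (h : IsPendantTreeAt (GadgetUWA1BAnchor o a₁ a₂ b) o a₁ a₂ b n E ends v S) (hy : y ∈ S)
    (hT : 0 < prob p (Tp ends a₁ a₂ y)) : RV p ends o a₁ a₂ y b :=
  rv_of_pendantTree (GadgetUWA1BAnchor o a₁ a₂ b) (fourForms_of_gadgetUWA1BAnchor o a₁ a₂ b) p hp h hy hT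

end Anchor

end CaseOne

end Summit.Ventures.PercRepro2
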